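import Mathlib
import HarnessLib
import Summits.ValiantsHypothesis.ValiantsHypothesis.Theses.MonotoneRestoration
import Literature.Computability.AlgebraicComplexity.ArithCircuit
import Literature.Computability.AlgebraicComplexity.ArithCircuitProofs
import Literature.Computability.AlgebraicComplexity.MonotoneStructure
import Literature.Computability.AlgebraicComplexity.PermanentIrreducible
import Literature.ModelTheory.FiniteModelTheory.CkEquiv
import Summits.ValiantsHypothesis.ValiantsHypothesis.Theorems.MonotoneRestorationMonotoneRestorationQPCosetCount
import Summits.ValiantsHypothesis.ValiantsHypothesis.Theorems.MonotoneRestorationMonotoneRestorationQPSymmetricLB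
import Summits.ValiantsHypothesis.ValiantsHypothesis.Theorems.MonotoneRestorationMonotoneRestorationQPSupportSymmetrisation
import Summits.ValiantsHypothesis.ValiantsHypothesis.Theorems.MonotoneRestorationMonotoneRestorationQPSparseRegime
import Summits.ValiantsHypothesis.ValiantsHypothesis.Theorems.MonotoneRestorationMonotoneRestorationQPBeta
import Literature.Computability.AlgebraicComplexity.SymmetricArithCircuit
import Literature.Computability.AlgebraicComplexity.DawarWilsenach2025Proofs
import Literature.GroupTheory.PermutationGroups.SmallIndexSubgroups
import Summits.ValiantsHypothesis.ValiantsHypothesis.Theorems.MonotoneRestorationQP.Negative.LoadBearing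
import Summits.ValiantsHypothesis.ValiantsHypothesis.Theorems.MonotoneRestorationMonotoneRestorationQPPermSupportCount

/-! TTRL-lite variant V19019 of stmt-ValiantsHypothesis-15886 -/

-- `Summit.ValiantsHypothesis.ValiantsHypothesis.…` is the tree's mandated single-conjunct layout
-- (Sub = Summit), so the duplicated namespace component is intended.
set_option linter.dupNamespace false

namespace Summit.ValiantsHypothesis.ValiantsHypothesis.Theorems

open Summit.ValiantsHypothesis.ValiantsHypothesis.Theses.MonotoneRestoration
open Literature.Computability.AlgebraicComplexity

/-- Truncating a gate keeps it plain (sum coefficients are kept, so they stay `1`). -/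
theorem isPlainGate_truncate_var19019 {k : Type*} {σ : Type*} [Zero k] [One k] (n : ℕ)
    {g : ArithCircuit.Gate k σ} (h : Literature.Barriers.ValiantsHypothesis.IsPlainGate g) :
    Literature.Barriers.ValiantsHypothesis.IsPlainGate (g.truncate n) := by
  cases g with
  | sum args =>
    simp only [ArithCircuit.Gate.truncate, Literature.Barriers.ValiantsHypothesis.IsPlainGate,
      List.mem_map]
    rintro _ ⟨a, ha, rfl⟩
    exact h a ha
  | prod args =>
    simp [ArithCircuit.Gate.truncate, Literature.Barriers.ValiantsHypothesis.IsPlainGate]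

/-- `trimJunk` keeps a circuit plain. -/
theorem isPlain_trimJunk_var19019 {k : Type*} {σ : Type*} [Zero k] [One k]
    {P : ArithCircuit k σ} (h : Literature.Barriers.ValiantsHypothesis.IsPlain P) :
    Literature.Barriers.ValiantsHypothesis.IsPlain P.trimJunk := by
  intro g hg
  simp only [ArithCircuit.trimJunk, List.mem_mapIdx] at hg
  obtain ⟨i, hi, rfl⟩ := hg
  exact isPlainGate_truncate_var19019 i (h _ (List.getElem_mem hi))

/-- TTRL-lite variant V19019: junk references never help in the plain (Jerrum–Snir) model either —
`trimJunk` keeps fan-in two, plainness and the computed polynomial, is well formed, and has the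
same size. -/
theorem stub_monotoneComputation_of_complexity_var19019 :
    ∀ (σ : Type) (P : ArithCircuit NNReal σ) (f : MvPolynomial σ NNReal),
      Literature.Barriers.ValiantsHypothesis.IsMonotoneComputation P f →
        Literature.Barriers.ValiantsHypothesis.IsMonotoneComputation P.trimJunk f ∧
          P.trimJunk.WellFormed ∧ P.trimJunk.size = P.size := by
  intro σ P f hP
  obtain ⟨hfan, hplain, hcomp⟩ := hP
  exact ⟨⟨hfan.trimJunk, isPlain_trimJunk_var19019 hplain, hcomp.trimJunk⟩,
    ArithCircuit.wellFormed_trimJunk P, ArithCircuit.size_trimJunk P⟩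

end Summit.ValiantsHypothesis.ValiantsHypothesis.Theorems
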